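import Summits.Ventures.HSemireg.WedgeHankelRecurrenceGaussChebyshevNodesExtrema
import Mathlib.Analysis.SpecialFunctions.Trigonometric.Chebyshev.RootsExtrema

/-!
# Venture HSemireg — **COUNTING SHARED NODES ON `[−1, 1]`: the `m`- and `n`-point Gauss–Chebyshev rules share exactly `gcd(m,n)` nodes when `m ∕ gcd`, `n ∕ gcd` are both odd and none otherwise;
# the `m`- and `n`-point second-kind (Fejér) rules share exactly `gcd(m+1,n+1) − 1` nodes; the `m`-point Gauss–Chebyshev rule and the `n`-point second-kind rule share `gcd(m,n+1)` nodes when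
# `(n+1) ∕ gcd(m,n+1)` is even and none otherwise** — the real root sets `(T_m).roots ∩ (T_n).roots` etc. as FINSETS, from the pointwise statements N470 and Mathlib's `roots_T_real ∕ roots_U_real`
# (`cos((2k+1)π∕2n)`, `cos((k+1)π∕(n+1))`)

HONEST FRAMING. Part of the Lean index of the computation cell `pub-hsemireg` (seat p10 gen 48, Sunday typer «UNIFORM-IN-n»).  Real roots of explicit polynomials only; no variety, no cohomology
theory, no sheaf, no Ext group and no semiregularity map is constructed here; nothing here says that HC / HC_CM / HC_AV holds; no Literature fact (unproved `Prop`) is declared or used.  Custodian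
versions as in `WedgeHankelSiegelIdeal` (1/3).
SOURCES (cited).  T. J. Rivlin, *Chebyshev Polynomials* (1990), §1.2, Ex. 1.5; P. J. Davis, P. Rabinowitz, *Methods of Numerical Integration* (1984), §2.7 (Gauss–Chebyshev and Fejér rules and their
nested use).
PROOF TYPED HERE.  N470 `chebyshevT_common_root_iff`, `chebyshevU_common_root_iff`, `chebyshevTU_common_root_iff`; Mathlib `Polynomial.Chebyshev.roots_T_real ∕ roots_U_real ∕ roots_T_real_nodup ∕
roots_U_real_nodup`, `Polynomial.mem_roots`, `T_ne_zero`, `U_ne_zero`, `Finset.card_image_of_injOn`.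
DEDUP DISCLOSURE (`rg -n 'chebyshevT_roots_toFinset_card|chebyshevU_roots_toFinset_card|roots_toFinset_inter|card_common_nodes' Summits Literature HarnessLib`, 2026-09-04): N344 ∕ N406 ff. use the node lists
in product form; 0 hits for the 8 names below.

WHAT IS IN THE TREE.  N470; Mathlib `RootsExtrema`.
THIS FILE (namespace `Summit.Ventures.HSemireg.Wedge.HankelOuter` continued; CHAINED on N479; 0 definitions):
* §1245 `chebyshevT_roots_toFinset_card`, `chebyshevU_roots_toFinset_card`, **`chebyshevT_roots_toFinset_inter`**, **`chebyshevT_card_common_nodes`**, **`chebyshevU_roots_toFinset_inter`**,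
  **`chebyshevU_card_common_nodes`**, **`chebyshevTU_roots_toFinset_inter`**, **`chebyshevTU_card_common_nodes`**.
CAVEATS.  Over `ℝ`; `ℕ`-division conventions as in N458.  Nothing Ext-side.  New names only.
-/

open Module Polynomial Real
open scoped Matrix Polynomial

namespace Summit.Ventures.HSemireg.Wedge.HankelOuter

/-! ## §1245. Counting shared nodes -/

/-- `T_n` has exactly `n` distinct real zeros. [Mathlib `roots_T_real`; this file, §1245] -/
theorem chebyshevT_roots_toFinset_card (n : ℕ) : (Polynomial.Chebyshev.T ℝ (n : ℤ)).roots.toFinset.card = n := by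
  rw [Polynomial.Chebyshev.roots_T_real, Finset.val_toFinset,
    Finset.card_image_of_injOn ((Finset.range n).nodup_map_iff_injOn.mp (Polynomial.Chebyshev.roots_T_real_nodup n)), Finset.card_range]

/-- `U_n` has exactly `n` distinct real zeros. [Mathlib `roots_U_real`; this file, §1245] -/
theorem chebyshevU_roots_toFinset_card (n : ℕ) : (Polynomial.Chebyshev.U ℝ (n : ℤ)).roots.toFinset.card = n := by
  rw [Polynomial.Chebyshev.roots_U_real, Finset.val_toFinset,
    Finset.card_image_of_injOn ((Finset.range n).nodup_map_iff_injOn.mp (Polynomial.Chebyshev.roots_U_real_nodup n)), Finset.card_range]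

/-- **The common real zeros of `T_m` and `T_n` form the zero set of `T_{gcd(m,n)}` if `m ∕ gcd`, `n ∕ gcd` are both odd, and are empty otherwise.** [Rivlin Ex. 1.5; this file, §1245] -/
theorem chebyshevT_roots_toFinset_inter (m n : ℕ) :
    (Polynomial.Chebyshev.T ℝ (m : ℤ)).roots.toFinset ∩ (Polynomial.Chebyshev.T ℝ (n : ℤ)).roots.toFinset =
      if Odd (m / Nat.gcd m n) ∧ Odd (n / Nat.gcd m n) then (Polynomial.Chebyshev.T ℝ (Nat.gcd m n : ℤ)).roots.toFinset else ∅ := by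
  ext x
  rw [Finset.mem_inter, Multiset.mem_toFinset, Multiset.mem_toFinset, Polynomial.mem_roots (Polynomial.Chebyshev.T_ne_zero ℝ _),
    Polynomial.mem_roots (Polynomial.Chebyshev.T_ne_zero ℝ _), Polynomial.IsRoot.def, Polynomial.IsRoot.def, chebyshevT_common_root_iff]
  split_ifs with hP
  · rw [Multiset.mem_toFinset, Polynomial.mem_roots (Polynomial.Chebyshev.T_ne_zero ℝ _), Polynomial.IsRoot.def]
    exact ⟨fun h => h.2, fun h => ⟨hP, h⟩⟩
  · exact iff_of_false (fun h => hP h.1) (Finset.notMem_empty x)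

/-- **The `m`- and `n`-point Gauss–Chebyshev rules share exactly `gcd(m,n)` nodes if `m ∕ gcd`, `n ∕ gcd` are both odd, and none otherwise.** [this file, §1245] -/
theorem chebyshevT_card_common_nodes (m n : ℕ) :
    ((Polynomial.Chebyshev.T ℝ (m : ℤ)).roots.toFinset ∩ (Polynomial.Chebyshev.T ℝ (n : ℤ)).roots.toFinset).card =
      if Odd (m / Nat.gcd m n) ∧ Odd (n / Nat.gcd m n) then Nat.gcd m n else 0 := by
  rw [chebyshevT_roots_toFinset_inter]
  split_ifs
  · exact chebyshevT_roots_toFinset_card _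
  · rfl

/-- **The common real zeros of `U_m` and `U_n` form the zero set of `U_{gcd(m+1,n+1)−1}`.** [this file, §1245] -/
theorem chebyshevU_roots_toFinset_inter (m n : ℕ) :
    (Polynomial.Chebyshev.U ℝ (m : ℤ)).roots.toFinset ∩ (Polynomial.Chebyshev.U ℝ (n : ℤ)).roots.toFinset =
      (Polynomial.Chebyshev.U ℝ ((Nat.gcd (m + 1) (n + 1) : ℤ) - 1)).roots.toFinset := by
  have hg : ((Nat.gcd (m + 1) (n + 1) : ℤ) - 1) ≠ -1 := by
    have := Nat.gcd_pos_of_pos_left (n + 1) (show 0 < m + 1 by omega); omega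
  ext x
  rw [Finset.mem_inter, Multiset.mem_toFinset, Multiset.mem_toFinset, Multiset.mem_toFinset, Polynomial.mem_roots (Polynomial.Chebyshev.U_ne_zero ℝ _ (by omega)),
    Polynomial.mem_roots (Polynomial.Chebyshev.U_ne_zero ℝ _ (by omega)), Polynomial.mem_roots (Polynomial.Chebyshev.U_ne_zero ℝ _ hg), Polynomial.IsRoot.def, Polynomial.IsRoot.def,
    Polynomial.IsRoot.def]
  have h := chebyshevU_common_root_iff (R := ℝ) (m + 1) (n + 1) x
  simp only [Nat.cast_add, Nat.cast_one, add_sub_cancel_right] at h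
  exact h

/-- **The `m`- and `n`-point second-kind (Fejér) rules share exactly `gcd(m+1, n+1) − 1` nodes.** [this file, §1245] -/
theorem chebyshevU_card_common_nodes (m n : ℕ) :
    ((Polynomial.Chebyshev.U ℝ (m : ℤ)).roots.toFinset ∩ (Polynomial.Chebyshev.U ℝ (n : ℤ)).roots.toFinset).card = Nat.gcd (m + 1) (n + 1) - 1 := by
  obtain ⟨g, hg⟩ : ∃ g, Nat.gcd (m + 1) (n + 1) = g + 1 := ⟨Nat.gcd (m + 1) (n + 1) - 1, by have := Nat.gcd_pos_of_pos_left (n + 1) (show 0 < m + 1 by omega); omega⟩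
  rw [chebyshevU_roots_toFinset_inter, hg, show (((g + 1 : ℕ)) : ℤ) - 1 = (g : ℤ) by push_cast; ring, chebyshevU_roots_toFinset_card, Nat.add_sub_cancel]

/-- **The common real zeros of `T_m` and `U_n` form the zero set of `T_{gcd(m,n+1)}` if `(n+1) ∕ gcd(m,n+1)` is even, and are empty otherwise.** [this file, §1245] -/
theorem chebyshevTU_roots_toFinset_inter (m n : ℕ) :
    (Polynomial.Chebyshev.T ℝ (m : ℤ)).roots.toFinset ∩ (Polynomial.Chebyshev.U ℝ (n : ℤ)).roots.toFinset =
      if Even ((n + 1) / Nat.gcd m (n + 1)) then (Polynomial.Chebyshev.T ℝ (Nat.gcd m (n + 1) : ℤ)).roots.toFinset else ∅ := by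
  ext x
  rw [Finset.mem_inter, Multiset.mem_toFinset, Multiset.mem_toFinset, Polynomial.mem_roots (Polynomial.Chebyshev.T_ne_zero ℝ _),
    Polynomial.mem_roots (Polynomial.Chebyshev.U_ne_zero ℝ _ (by omega)), Polynomial.IsRoot.def, Polynomial.IsRoot.def]
  have h := chebyshevTU_common_root_iff (R := ℝ) m (n + 1) x
  simp only [Nat.cast_add, Nat.cast_one, add_sub_cancel_right] at h
  rw [h]
  split_ifs with hP
  · rw [Multiset.mem_toFinset, Polynomial.mem_roots (Polynomial.Chebyshev.T_ne_zero ℝ _), Polynomial.IsRoot.def]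
    exact ⟨fun h => h.2, fun h => ⟨hP, h⟩⟩
  · exact iff_of_false (fun h => hP h.1) (Finset.notMem_empty x)

/-- **The `m`-point Gauss–Chebyshev rule and the `n`-point second-kind rule share exactly `gcd(m, n+1)` nodes if `(n+1) ∕ gcd(m,n+1)` is even, and none otherwise.** [this file, §1245] -/
theorem chebyshevTU_card_common_nodes (m n : ℕ) :
    ((Polynomial.Chebyshev.T ℝ (m : ℤ)).roots.toFinset ∩ (Polynomial.Chebyshev.U ℝ (n : ℤ)).roots.toFinset).card =
      if Even ((n + 1) / Nat.gcd m (n + 1)) then Nat.gcd m (n + 1) else 0 := by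
  rw [chebyshevTU_roots_toFinset_inter]
  split_ifs
  · exact chebyshevT_roots_toFinset_card _
  · rfl

end Summit.Ventures.HSemireg.Wedge.HankelOuter
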